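import Mathlib
import Summits.AtomisticToContinuum.Crystallization.Theses.NashClassCertificates
import Summits.AtomisticToContinuum.Crystallization.Theorems.NashClassCertificatesNashTwoShellGapForceBalance
import Summits.AtomisticToContinuum.Crystallization.Theorems.ExcessDecayLiouvilleLinearisation
import Literature.Analysis.Calculus.CriticalConvexGap

/-!
# Crux `NashNearField` (stmt-AtomisticToContinuum-16827), line `birth`: P-min — tube coercivity + force balance ⇒ quadratic energy gap

Registered sub-goal `stub_minimalityOfTubeCoercivity` of the lead's analysis stub
`stub_flatnessOfTubeCoercivity : TC → A″`.  Statement: IF the Lennard-Jones force-constant form is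
tube-coercive on good regions (the premise, verbatim the registered `stub_tubeCoercivity`), THEN every
force-balanced configuration `x` is a local minimiser with a quadratic gap in the nearest-neighbour strain
norm against perturbations `v` supported in a good region `Ω'` which keep the configuration in the tube:

  `κ · Σ_i Σ_{j ≠ i} [ |x_i − x_j| ≤ 26/25 ] ‖v_i − v_j‖² ≤ E(x + v) − E(x)`.

Proof: the one-variable function `f(t) = E(x + t v)` has `f′(0) = 0` by force balance (reindex the pair
sum) and `f″(t) = ½ Σ_i Σ_{j ≠ i} Hess₀(y_i − y_j)(v_i − v_j)`, `y = x + t v`, which the premise bounds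
below by `κ₀ Σ [ |y_i − y_j| ≤ 11/10 ] ‖v_i − v_j‖² ≥ κ₀ Σ [ |x_i − x_j| ≤ 26/25 ] ‖v_i − v_j‖²`
(`‖v_i‖ ≤ 1/50`); then `f(1) − f(0) ≥ κ₀ S / 2` (`Literature.Analysis.Calculus.sub_ge_half_of_deriv2_ge`).
The per-bond calculus (`t ↦ V(‖e + t w‖)` has first derivative `h(‖e+tw‖²)⟪e + t w, w⟫`,
`h(s) = −s⁻⁷ + s⁻⁴ = V′(√s)/√s`, and second derivative `Hess₀ (e + t w) w`) goes through the polynomial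
`‖e + t w‖²` (`NashTwoShellGapForceBalance.norm_add_smul_sq`, `hasDerivAt_profile`, `lennardJones_norm_eq`;
`ExcessDecayLiouville.hasDerivAt_ljProfile`; `PhononStabilityNegative.Hess₀`, `deriv_lennardJones`,
`deriv_deriv_lennardJones`).  All `[folklore]`; a `--supports` piece, nothing here closes an item.
-/

noncomputable section

namespace Summit.AtomisticToContinuum.Crystallization.Theorems.NashClassCertificatesNashNearField

open scoped BigOperators RealInnerProductSpace
open Literature.MathematicalPhysics.StatisticalMechanics Literature.Geometry.DiscreteGeometry
open Summit.AtomisticToContinuum.Crystallization.Theorems.PhononStabilityNegative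
  (Hess₀ deriv_lennardJones deriv_deriv_lennardJones Hess₀_neg_left Hess₀_neg_right)
open Summit.AtomisticToContinuum.Crystallization.Theorems.ExcessDecayLiouville (hasDerivAt_ljProfile)
open Summit.AtomisticToContinuum.Crystallization.Theorems.NashTwoShellGapForceBalance
  (lennardJones_norm_eq hasDerivAt_profile norm_add_smul_sq)

/-! ## Per-bond calculus along a segment -/

/-- `⟪e + t w, w⟫ = ⟪e, w⟫ + t ‖w‖²`. [folklore] -/
theorem pmin_inner_add_smul (e w : EuclideanSpace ℝ (Fin 3)) (t : ℝ) :
    ⟪e + t • w, w⟫ = ⟪e, w⟫ + t * ‖w‖ ^ 2 := by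
  rw [inner_add_left, real_inner_smul_left, real_inner_self_eq_norm_sq]

/-- `d/dt ‖e + t w‖² = 2⟪e + t w, w⟫` (through the polynomial `‖e‖² + 2t⟪e,w⟫ + t²‖w‖²`,
`NashTwoShellGapForceBalance.norm_add_smul_sq`). [folklore] -/
theorem pmin_hasDerivAt_norm_sq (e w : EuclideanSpace ℝ (Fin 3)) (t : ℝ) :
    HasDerivAt (fun s : ℝ => ‖e + s • w‖ ^ 2) (2 * ⟪e + t • w, w⟫) t := by
  have h : HasDerivAt (fun s : ℝ => ‖e‖ ^ 2 + 2 * s * ⟪e, w⟫ + s ^ 2 * ‖w‖ ^ 2)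
      (0 + 2 * 1 * ⟪e, w⟫ + ((2 : ℕ) * (id t) ^ (2 - 1) * 1) * ‖w‖ ^ 2) t := by
    refine ((hasDerivAt_const t (‖e‖ ^ 2)).fun_add ?_).fun_add ?_
    · exact ((hasDerivAt_id t).const_mul 2).mul_const _
    · exact ((hasDerivAt_id t).fun_pow 2).mul_const _
  have hfun : (fun s : ℝ => ‖e + s • w‖ ^ 2) = fun s : ℝ => ‖e‖ ^ 2 + 2 * s * ⟪e, w⟫ + s ^ 2 * ‖w‖ ^ 2 :=
    funext fun s => norm_add_smul_sq e w s
  rw [hfun]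
  refine h.congr_deriv ?_
  rw [pmin_inner_add_smul]
  simp
  ring

/-- `d/dt ⟪e + t w, w⟫ = ‖w‖²`. [folklore] -/
theorem pmin_hasDerivAt_inner (e w : EuclideanSpace ℝ (Fin 3)) (t : ℝ) :
    HasDerivAt (fun s : ℝ => ⟪e + s • w, w⟫) (‖w‖ ^ 2) t := by
  have hfun : (fun s : ℝ => ⟪e + s • w, w⟫) = fun s : ℝ => ⟪e, w⟫ + s * ‖w‖ ^ 2 :=
    funext fun s => pmin_inner_add_smul e w s
  rw [hfun]
  simpa using ((hasDerivAt_id t).mul_const (‖w‖ ^ 2)).const_add ⟪e, w⟫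

/-- `h(r²) = V′(r)/r` for `r ≠ 0`. [folklore] -/
theorem pmin_profile_eq_deriv_div {r : ℝ} (hr : r ≠ 0) :
    -((r ^ 2)⁻¹) ^ 7 + ((r ^ 2)⁻¹) ^ 4 = deriv lennardJones r / r := by
  rw [deriv_lennardJones hr]
  field_simp

/-- **First derivative of one bond energy along a segment**: for `e + t w ≠ 0`,
`d/ds V(‖e + s w‖) |_{s = t} = h(‖e + t w‖²) ⟪e + t w, w⟫`. [folklore] -/
theorem pmin_hasDerivAt_bond (e w : EuclideanSpace ℝ (Fin 3)) {t : ℝ} (h : e + t • w ≠ 0) :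
    HasDerivAt (fun s : ℝ => lennardJones ‖e + s • w‖)
      ((-((‖e + t • w‖ ^ 2)⁻¹) ^ 7 + ((‖e + t • w‖ ^ 2)⁻¹) ^ 4) * ⟪e + t • w, w⟫) t := by
  have hP0 : ‖e + t • w‖ ^ 2 ≠ 0 := pow_ne_zero 2 (norm_ne_zero_iff.2 h)
  have hW : HasDerivAt (fun u : ℝ => (1 / 12) * (u⁻¹) ^ 6 - (1 / 6) * (u⁻¹) ^ 3)
      (-(1 / 2) * ((‖e + t • w‖ ^ 2)⁻¹) ^ 7 + (1 / 2) * ((‖e + t • w‖ ^ 2)⁻¹) ^ 4)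
      ((fun s : ℝ => ‖e + s • w‖ ^ 2) t) := hasDerivAt_profile hP0
  have hc := hW.comp t (pmin_hasDerivAt_norm_sq e w t)
  have hfun : (fun s : ℝ => lennardJones ‖e + s • w‖) =
      (fun u : ℝ => (1 / 12) * (u⁻¹) ^ 6 - (1 / 6) * (u⁻¹) ^ 3) ∘ fun s : ℝ => ‖e + s • w‖ ^ 2 := by
    funext s
    simp only [Function.comp, lennardJones_norm_eq]
  rw [hfun]
  refine hc.congr_deriv ?_
  ring

/-- **Second derivative of one bond energy along a segment**: for `e + t w ≠ 0`, the derivative at `t` of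
`s ↦ h(‖e + s w‖²) ⟪e + s w, w⟫` is the force-constant form `Hess₀ (e + t w) w`. [folklore] -/
theorem pmin_hasDerivAt_bond' (e w : EuclideanSpace ℝ (Fin 3)) {t : ℝ} (h : e + t • w ≠ 0) :
    HasDerivAt (fun s : ℝ => (-((‖e + s • w‖ ^ 2)⁻¹) ^ 7 + ((‖e + s • w‖ ^ 2)⁻¹) ^ 4) * ⟪e + s • w, w⟫)
      (Hess₀ (e + t • w) w) t := by
  have hr : ‖e + t • w‖ ≠ 0 := norm_ne_zero_iff.2 h
  have hP0 : ‖e + t • w‖ ^ 2 ≠ 0 := pow_ne_zero 2 hr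
  have hh : HasDerivAt (fun y : ℝ => -(y⁻¹) ^ 7 + (y⁻¹) ^ 4)
      (7 * ((‖e + t • w‖ ^ 2)⁻¹) ^ 8 - 4 * ((‖e + t • w‖ ^ 2)⁻¹) ^ 5)
      ((fun s : ℝ => ‖e + s • w‖ ^ 2) t) := hasDerivAt_ljProfile hP0
  have hc := hh.comp t (pmin_hasDerivAt_norm_sq e w t)
  have hm := hc.fun_mul (pmin_hasDerivAt_inner e w t)
  have hfun : (fun s : ℝ => (-((‖e + s • w‖ ^ 2)⁻¹) ^ 7 + ((‖e + s • w‖ ^ 2)⁻¹) ^ 4) * ⟪e + s • w, w⟫) =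
      fun s : ℝ => ((fun y : ℝ => -(y⁻¹) ^ 7 + (y⁻¹) ^ 4) ∘ fun s : ℝ => ‖e + s • w‖ ^ 2) s * ⟪e + s • w, w⟫ := by
    funext s
    simp only [Function.comp]
  rw [hfun]
  refine hm.congr_deriv ?_
  simp only [Function.comp]
  rw [Hess₀, deriv_deriv_lennardJones hr, deriv_lennardJones hr]
  field_simp
  ring

/-! ## Reindexing pair sums -/

/-- `Σ_i Σ_{j > i} a i j = ½ Σ_i Σ_{j ≠ i} a i j` for a symmetric array. [folklore] -/
theorem pmin_sum_Ioi_eq_half {N : ℕ} (a : Fin N → Fin N → ℝ) (ha : ∀ i j, a i j = a j i) :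
    ∑ i, ∑ j ∈ Finset.Ioi i, a i j = (1 / 2 : ℝ) * ∑ i, ∑ j ∈ Finset.univ.erase i, a i j := by
  -- adapted from `two_mul_interactionEnergy` (LennardJonesClusters.lean)
  have hsplit : ∀ i : Fin N, Finset.univ.erase i = Finset.Ioi i ∪ Finset.Iio i := fun i => by
    ext k
    simp only [Finset.mem_erase, Finset.mem_univ, and_true, Finset.mem_union, Finset.mem_Ioi,
      Finset.mem_Iio]
    exact ne_iff_lt_or_gt.trans or_comm
  have hdisj : ∀ i : Fin N, Disjoint (Finset.Ioi i) (Finset.Iio i) := fun i =>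
    Finset.disjoint_left.2 fun k hk hk' => lt_asymm (Finset.mem_Ioi.1 hk) (Finset.mem_Iio.1 hk')
  have h1 : ∑ i, ∑ k ∈ Finset.Iio i, a i k = ∑ i, ∑ k ∈ Finset.Ioi i, a i k := by
    rw [Finset.sum_comm' (t' := Finset.univ) (s' := fun k => Finset.Ioi k)]
    · exact Finset.sum_congr rfl fun k _ => Finset.sum_congr rfl fun i _ => ha i k
    · intro i k
      simp
  simp only [hsplit, Finset.sum_union (hdisj _), Finset.sum_add_distrib, h1]
  ring

/-- **Virtual work**: `Σ_i Σ_{j ≠ i} c_ij ⟪x_i − x_j, v_i − v_j⟫ = 2 Σ_i ⟪Σ_{j ≠ i} c_ij (x_i − x_j), v_i⟫`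
for symmetric coefficients `c`. [folklore] -/
theorem pmin_sum_inner_eq {N : ℕ} (x v : Fin N → EuclideanSpace ℝ (Fin 3)) (c : Fin N → Fin N → ℝ)
    (hc : ∀ i j, c i j = c j i) :
    ∑ i, ∑ j ∈ Finset.univ.erase i, c i j * ⟪x i - x j, v i - v j⟫ =
      2 * ∑ i, ⟪∑ j ∈ Finset.univ.erase i, c i j • (x i - x j), v i⟫ := by
  have h1 : ∀ i j, c i j * ⟪x i - x j, v i - v j⟫ =
      c i j * ⟪x i - x j, v i⟫ - c i j * ⟪x i - x j, v j⟫ := by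
    intro i j
    rw [inner_sub_right]
    ring
  have h2 : ∑ i, ∑ j ∈ Finset.univ.erase i, c i j * ⟪x i - x j, v j⟫ =
      -∑ i, ∑ j ∈ Finset.univ.erase i, c i j * ⟪x i - x j, v i⟫ := by
    -- swap the two indices of the off-diagonal double sum
    have hswap : ∑ i, ∑ j ∈ Finset.univ.erase i, c i j * ⟪x i - x j, v j⟫ =
        ∑ j, ∑ i ∈ Finset.univ.erase j, c i j * ⟪x i - x j, v j⟫ := by
      refine Finset.sum_comm' fun i j => ?_
      simp only [Finset.mem_univ, Finset.mem_erase, true_and, and_true]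
      exact ne_comm
    rw [hswap, ← Finset.sum_neg_distrib]
    refine Finset.sum_congr rfl fun a _ => ?_
    rw [← Finset.sum_neg_distrib]
    refine Finset.sum_congr rfl fun b _ => ?_
    rw [hc b a, ← neg_sub (x a) (x b), inner_neg_left]
    ring
  simp_rw [h1, Finset.sum_sub_distrib, h2, sum_inner, real_inner_smul_left]
  ring

/-! ## The registered sub-goal -/

/-- **Registered sub-goal `stub_minimalityOfTubeCoercivity` (P-min)**: tube coercivity of the
Lennard-Jones force-constant form on good regions (the premise, verbatim `stub_tubeCoercivity`) and force
balance make `x` a minimiser with a quadratic gap in the nearest-neighbour strain norm against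
tube-preserving perturbations supported in the good region: `κ Σ_i Σ_{j≠i} [r_ij ≤ 26/25] ‖v_i − v_j‖² ≤
E(x+v) − E(x)` with `κ = κ₀/2`.  One-variable convexity of `t ↦ E(x + t v)` at its critical point `0`.
[folklore] -/
theorem stub_minimalityOfTubeCoercivity :
    (∃ κ : ℝ, 0 < κ ∧ ∀ (N : ℕ) (x : Fin N → EuclideanSpace ℝ (Fin 3)), (∀ i j : Fin N, i ≠ j → 1 / 3 ≤ dist (x i) (x j)) →
      ∀ Ω' : Finset (Fin N),
        (∀ i ∈ Ω', ∀ j : Fin N, dist (x j) (x i) ≤ 4 → IsTwoShellGood (1 / 20) (47 / 50) 1 x j) →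
        ∀ u : Fin N → EuclideanSpace ℝ (Fin 3), (∀ i, i ∉ Ω' → u i = 0) →
          κ * (∑ i, ∑ j ∈ Finset.univ.erase i, (if dist (x i) (x j) ≤ 11 / 10 then ‖u i - u j‖ ^ 2 else 0)) ≤
            (1 / 2 : ℝ) * ∑ i, ∑ j ∈ Finset.univ.erase i, (fun (e w : EuclideanSpace ℝ (Fin 3)) => deriv (deriv lennardJones) ‖e‖ * (inner ℝ e w / ‖e‖) ^ 2 + deriv lennardJones ‖e‖ / ‖e‖ * (‖w‖ ^ 2 - (inner ℝ e w / ‖e‖) ^ 2)) (x i - x j) (u i - u j)) →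
    ∃ κ : ℝ, 0 < κ ∧ ∀ (N : ℕ) (x v : Fin N → EuclideanSpace ℝ (Fin 3)) (Ω' : Finset (Fin N)),
      (∀ i : Fin N, ∑ j ∈ Finset.univ.erase i, (deriv lennardJones (dist (x i) (x j)) / dist (x i) (x j)) • (x i - x j) = 0) →
      (∀ i : Fin N, i ∉ Ω' → v i = 0) →
      (∀ t : ℝ, t ∈ Set.Icc (0 : ℝ) 1 →
        (∀ i j : Fin N, i ≠ j → 1 / 3 ≤ dist (x i + t • v i) (x j + t • v j)) ∧
        (∀ i ∈ Ω', ∀ j : Fin N, dist (x j + t • v j) (x i + t • v i) ≤ 4 →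
          IsTwoShellGood (1 / 20) (47 / 50) 1 (fun k => x k + t • v k) j)) →
      (∀ i : Fin N, ‖v i‖ ≤ 1 / 50) →
      κ * (∑ i, ∑ j ∈ Finset.univ.erase i, (if dist (x i) (x j) ≤ 26 / 25 then ‖v i - v j‖ ^ 2 else 0)) ≤
        interactionEnergy lennardJones (fun k => x k + v k) - interactionEnergy lennardJones x := by
  rintro ⟨κ₀, hκ₀, hTC⟩
  refine ⟨κ₀ / 2, by positivity, ?_⟩
  intro N x v Ω' hFB hsupp htube hsmall
  set S : ℝ := ∑ i, ∑ j ∈ Finset.univ.erase i,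
    (if dist (x i) (x j) ≤ 26 / 25 then ‖v i - v j‖ ^ 2 else 0) with hS
  -- bond vectors along the segment never vanish
  have hseg : ∀ i j : Fin N, ∀ t : ℝ, x i + t • v i - (x j + t • v j) = x i - x j + t • (v i - v j) := by
    intro i j t
    rw [smul_sub]
    abel
  have hne : ∀ t ∈ Set.Icc (0 : ℝ) 1, ∀ i j : Fin N, i ≠ j → x i - x j + t • (v i - v j) ≠ 0 := by
    intro t ht i j hij h0
    have h13 := (htube t ht).1 i j hij
    rw [dist_eq_norm, hseg, h0, norm_zero] at h13
    norm_num at h13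
  -- the energy along the segment and its first two derivatives
  set f : ℝ → ℝ := fun t => interactionEnergy lennardJones (fun k => x k + t • v k) with hf_def
  set f' : ℝ → ℝ := fun t => ∑ i, ∑ j ∈ Finset.Ioi i,
    (-((‖x i - x j + t • (v i - v j)‖ ^ 2)⁻¹) ^ 7 + ((‖x i - x j + t • (v i - v j)‖ ^ 2)⁻¹) ^ 4) *
      ⟪x i - x j + t • (v i - v j), v i - v j⟫ with hf'_def
  set f'' : ℝ → ℝ := fun t => ∑ i, ∑ j ∈ Finset.Ioi i,
    Hess₀ (x i - x j + t • (v i - v j)) (v i - v j) with hf''_def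
  have hfeq : f = fun t => ∑ i, ∑ j ∈ Finset.Ioi i, lennardJones ‖x i - x j + t • (v i - v j)‖ := by
    funext t
    simp only [hf_def, interactionEnergy, dist_eq_norm, hseg]
  have hf : ∀ t ∈ Set.Icc (0 : ℝ) 1, HasDerivAt f (f' t) t := by
    intro t ht
    rw [hfeq, hf'_def]
    exact HasDerivAt.fun_sum fun i _ => HasDerivAt.fun_sum fun j hj =>
      pmin_hasDerivAt_bond (x i - x j) (v i - v j) (hne t ht i j (Finset.mem_Ioi.1 hj).ne)
  have hf' : ∀ t ∈ Set.Icc (0 : ℝ) 1, HasDerivAt f' (f'' t) t := by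
    intro t ht
    rw [hf'_def, hf''_def]
    exact HasDerivAt.fun_sum fun i _ => HasDerivAt.fun_sum fun j hj =>
      pmin_hasDerivAt_bond' (x i - x j) (v i - v j) (hne t ht i j (Finset.mem_Ioi.1 hj).ne)
  -- `f′(0) = 0` : force balance
  have hx0 : ∀ i j : Fin N, i ≠ j → x i - x j ≠ 0 := by
    intro i j hij
    simpa using hne 0 (Set.left_mem_Icc.2 zero_le_one) i j hij
  have h0 : f' 0 = 0 := by
    rw [hf'_def]
    simp only [zero_smul, add_zero]
    rw [pmin_sum_Ioi_eq_half (fun i j => (-((‖x i - x j‖ ^ 2)⁻¹) ^ 7 + ((‖x i - x j‖ ^ 2)⁻¹) ^ 4) *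
      ⟪x i - x j, v i - v j⟫) (fun i j => by rw [← neg_sub (x i) (x j), ← neg_sub (v i) (v j), inner_neg_neg, norm_neg])]
    rw [pmin_sum_inner_eq x v (fun i j => -((‖x i - x j‖ ^ 2)⁻¹) ^ 7 + ((‖x i - x j‖ ^ 2)⁻¹) ^ 4)
      (fun i j => by rw [← neg_sub (x i) (x j), norm_neg])]
    have hF : ∀ i : Fin N, ∑ j ∈ Finset.univ.erase i,
        (-((‖x i - x j‖ ^ 2)⁻¹) ^ 7 + ((‖x i - x j‖ ^ 2)⁻¹) ^ 4) • (x i - x j) = 0 := by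
      intro i
      rw [← hFB i]
      refine Finset.sum_congr rfl fun j hj => ?_
      rw [pmin_profile_eq_deriv_div (norm_ne_zero_iff.2 (hx0 i j (Finset.ne_of_mem_erase hj).symm)),
        dist_eq_norm]
    beta_reduce
    simp only [hF, inner_zero_left, Finset.sum_const_zero, mul_zero]
  -- `f″(t) ≥ κ₀ S` : tube coercivity at the configuration `x + t v`
  have hm : ∀ t ∈ Set.Icc (0 : ℝ) 1, κ₀ * S ≤ f'' t := by
    intro t ht
    have hTC' := hTC N (fun k => x k + t • v k) (htube t ht).1 Ω' (htube t ht).2 v hsupp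
    -- the left-hand side dominates `S`
    have hLHS : S ≤ ∑ i, ∑ j ∈ Finset.univ.erase i,
        (if dist (x i + t • v i) (x j + t • v j) ≤ 11 / 10 then ‖v i - v j‖ ^ 2 else 0) := by
      rw [hS]
      refine Finset.sum_le_sum fun i _ => Finset.sum_le_sum fun j _ => ?_
      have htv : ∀ k : Fin N, ‖t • v k‖ ≤ 1 / 50 := by
        intro k
        rw [norm_smul, Real.norm_eq_abs, abs_of_nonneg ht.1]
        calc t * ‖v k‖ ≤ 1 * ‖v k‖ := mul_le_mul_of_nonneg_right ht.2 (norm_nonneg _)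
          _ ≤ 1 / 50 := by rw [one_mul]; exact hsmall k
      have hdist : dist (x i + t • v i) (x j + t • v j) ≤ dist (x i) (x j) + (1 / 50 + 1 / 50) :=
        calc dist (x i + t • v i) (x j + t • v j) ≤ dist (x i) (x j) + dist (t • v i) (t • v j) :=
              dist_add_add_le _ _ _ _
          _ ≤ dist (x i) (x j) + (‖t • v i‖ + ‖t • v j‖) := by
              gcongr; exact dist_le_norm_add_norm _ _
          _ ≤ dist (x i) (x j) + (1 / 50 + 1 / 50) := by gcongr <;> exact htv _
      split_ifs with h1 h2
      · exact le_rfl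
      · exfalso; apply h2; linarith
      · positivity
      · exact le_rfl
    -- the right-hand side is `f″(t)`
    have hRHS : (1 / 2 : ℝ) * ∑ i, ∑ j ∈ Finset.univ.erase i,
        Hess₀ (x i + t • v i - (x j + t • v j)) (v i - v j) = f'' t := by
      rw [hf''_def]
      dsimp only
      rw [pmin_sum_Ioi_eq_half (fun i j => Hess₀ (x i - x j + t • (v i - v j)) (v i - v j)) (fun i j => by
        rw [← Hess₀_neg_left, ← Hess₀_neg_right, neg_sub, smul_sub, smul_sub]
        congr 1; abel)]
      simp only [hseg]
    calc κ₀ * S ≤ κ₀ * ∑ i, ∑ j ∈ Finset.univ.erase i,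
          (if dist (x i + t • v i) (x j + t • v j) ≤ 11 / 10 then ‖v i - v j‖ ^ 2 else 0) :=
          mul_le_mul_of_nonneg_left hLHS hκ₀.le
      _ ≤ (1 / 2 : ℝ) * ∑ i, ∑ j ∈ Finset.univ.erase i,
          Hess₀ (x i + t • v i - (x j + t • v j)) (v i - v j) := hTC'
      _ = f'' t := hRHS
  -- the one-variable gap lemma
  have hgap : κ₀ * S / 2 ≤ f 1 - f 0 :=
    Literature.Analysis.Calculus.sub_ge_half_of_deriv2_ge hf hf' h0 hm
  have hf1 : f 1 = interactionEnergy lennardJones (fun k => x k + v k) := by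
    simp [hf_def]
  have hf0 : f 0 = interactionEnergy lennardJones x := by
    simp [hf_def]
  rw [hf1, hf0] at hgap
  linarith

end Summit.AtomisticToContinuum.Crystallization.Theorems.NashClassCertificatesNashNearField

end
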